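import Literature.NumberTheory.EllipticCurves.HeegnerPointsKolyvaginProofs
import Literature.NumberTheory.EllipticCurves.HeegnerHypothesisKroneckerProofs
import Literature.NumberTheory.EllipticCurves.ComplexMultiplicationNotSemistable
import Literature.NumberTheory.EllipticCurves.ModularityVersionApProofs
import Summits.BirchSwinnertonDyer.Rank1Residual.Partition.Rows
import Summits.BirchSwinnertonDyer.Rank1Residual.X11b.KolyvaginShaFiniteOfLeafInputs
import HarnessLib

/-!
# The leaf `hexc` (CM / `d_K ∈ {−3, −4}`) is IDLE at levels divisible by `3`

Cell `b2b-bsdres`, team x11b3 (N8/O2: X11b @ 3, `3 ‖ N`, `r = 1`, `E[3]` irreducible); seat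
x11b3-p2 GEN 34, finding (P2-HEXC-IDLE).  Summit-side THEOREM-ONLY file (no definition, no named
fact, no `sorry`); `K : Type`.

HONEST FRAMING (binding): theorems only; nothing booked; no mark / label / count / tier moves;
node `Three.HsiehDescentAt₃` and its antecedents untouched.  What is shown is that ONE labelled
hypothesis of the Kolyvagin-side telescope of record
(`KolyvaginAssembly.sha_primary_finite_of_leafInputs_of_poitouTate`,
`X11b/KolyvaginShaFiniteOfLeafInputs`), namely
`hexc : Kolyvagin1990_thmA_of_hasCM_or_discr N W K` — Kolyvagin's Theorem A in the cases Gross's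
exposition sets aside: `E` with CM, or `d_K ∈ {−3, −4}` — holds VACUOUSLY whenever `E` has no CM
and `3 ∣ N`: the leaf's own binders carry the Heegner hypothesis for `(N, K)` (every `p ∣ N`
splits in `K`), and `3` splits neither in `ℚ(√−3)` (ramified: `3 ∣ d_K`) nor in `ℚ(i)`
(inert: `(−4/3) = −1`), so `d_K ∉ {−3, −4}`; a curve with multiplicative reduction at `3` has no
CM (`j ∉ ℤ`; tree `WeierstrassCurve.not_hasMultiplicativeReductionAtPrime_of_hasCM`).  Hence on
the class X11b @ 3 (`ClassX11b W 3`: `r_an = 1 ∧ 3 ≠ 2 ∧ mult(3) ∧ irr(3)`) at the conductor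
`N = N_E` the label `hexc` is a TREE THEOREM, and the telescope carries SEVEN cite-only inputs
{`hPT`, `hrec`, `hCM`, `h53`, `hGZ`, `hγ`, `hK1`} instead of eight
(`Three.sha_primary_finite_of_leafInputs_of_poitouTate_of_mult_three`).  The other
labels are NOT touched: (γ), (A′-53), [GZ86 III (3.1)], `hCM`, `hrec`, `hPT`, `hK1` stay
cite-only.

## What is proved

* `Three.KolyvaginHexc.discr_ne_of_satisfiesHeegnerHypothesis_of_three_dvd` — `[K : ℚ] = 2`, Heegner
  hypothesis for `N`, `3 ∣ N` ⟹ `d_K ≠ −3 ∧ d_K ≠ −4`.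
* `Three.KolyvaginHexc.thmA_of_hasCM_or_discr_of_not_hasCM_of_three_dvd` — `E` non-CM, `3 ∣ N` ⟹
  `Kolyvagin1990_thmA_of_hasCM_or_discr N W K` (every `K`).
* `Three.KolyvaginHexc.thmA_of_hasCM_or_discr_of_hasMultiplicativeReductionAtPrime_three` —
  `3 ‖ N_E`, `N = N_E` ⟹ the same.
* `Three.KolyvaginHexc.thmA_of_hasCM_or_discr_of_classX11b_three` — on `ClassX11b W 3` at `N = N_E`.
* `Three.sha_primary_finite_of_leafInputs_of_poitouTate_of_mult_three` — the
  telescope of record with `hexc` SUPPLIED from `hmult : W.HasMultiplicativeReductionAtPrime 3`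
  (binders otherwise VERBATIM those of `sha_primary_finite_of_leafInputs_of_poitouTate`).

## References

* [GrossLMS1991] B. H. Gross, *Kolyvagin's work on modular elliptic curves*, LMS LNS 153 (1991),
  §1 ("for simplicity, we assume that `D ≠ 3, 4`"), Thm. 1.3.
* [McCallumLMS1991] W. G. McCallum, *Kolyvagin's work on Shafarevich–Tate groups*, same volume,
  §1 Theorem (Kolyvagin).
* [Darmon2004] H. Darmon, *Rational Points on Modular Elliptic Curves*, CBMS 101, Hypothesis 3.9.
* [SilvermanATAEC1994] J. H. Silverman, *Advanced Topics*, Thm. II.6.4 and proof of II.10.5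
  (CM ⟹ `j` integral ⟹ no multiplicative prime).

presearch: vacuity observation on a tree Prop; `lean search 'of_hasCM_or_discr_of_not_hasCM'` →
the tree's `…ExceptionalTwistProofs` derives the non-CM half of the leaf over `ℚ(i)`, `ℚ(√−3)`
from the MAIN CASE by twists (conditional on `kolyvagin` at main-case instances); the present
route needs nothing (the Heegner hypothesis with `3 ∣ N` excludes those two fields).
-/

noncomputable section

open scoped Classical
open WeierstrassCurve NumberField
open Literature.NumberTheory.EllipticCurves Literature.NumberTheory.EllipticCurves.Rank1Residual

namespace Summit.BirchSwinnertonDyer.Rank1Residual.X11b.Three.KolyvaginHexc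

variable {K : Type} [Field K] [NumberField K] {N : ℕ} [NeZero N] {W : WeierstrassCurve ℚ}

omit [NeZero N] in

/-- **`3 ∣ N` and the Heegner hypothesis exclude `ℚ(√−3)` and `ℚ(i)`.**  For a quadratic field
`K` in which every prime dividing `N` splits and `3 ∣ N`: `d_K ≠ −3` (a split prime is
unramified, `3 ∤ d_K`: tree `Literature.SatisfiesHeegnerHypothesis.not_dvd_discr`) and `d_K ≠ −4`
(`(d_K/3) = 1` at the odd split prime `3`, tree
`Literature.SatisfiesHeegnerHypothesis.jacobiSym_discr_eq_one`, while `(−4/3) = −1`).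
Darmon 2004, Hypothesis 3.9 with Prop. 3.8. [folklore] -/
theorem discr_ne_of_satisfiesHeegnerHypothesis_of_three_dvd (h2 : Module.finrank ℚ K = 2)
    (hH : SatisfiesHeegnerHypothesis N K) (h3 : 3 ∣ N) :
    NumberField.discr K ≠ -3 ∧ NumberField.discr K ≠ -4 := by
  refine ⟨fun hd ↦ ?_, fun hd ↦ ?_⟩
  · exact Literature.SatisfiesHeegnerHypothesis.not_dvd_discr h2 hH Nat.prime_three h3
      (by rw [hd]; norm_num)
  · have hj := Literature.SatisfiesHeegnerHypothesis.jacobiSym_discr_eq_one h2 hH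
      Nat.prime_three h3 (by norm_num)
    rw [hd] at hj
    have h43 : jacobiSym (-4) 3 = -1 := by
      rw [jacobiSym.mod_left]
      norm_num [jacobiSym.at_two, ZMod.χ₈_nat_eq_if_mod_eight]
    rw [h43] at hj
    exact absurd hj (by norm_num)

/-- **The leaf `hexc` is idle for non-CM `E` at levels `3 ∣ N`.**  Kolyvagin's Theorem A in the
cases set aside by Gross 1991 (`Kolyvagin1990_thmA_of_hasCM_or_discr N W K`: `E` with CM, or
`d_K ∈ {−3, −4}`) holds VACUOUSLY when `E` has no CM and `3 ∣ N`: the leaf's antecedent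
`W.HasCM ∨ d_K = −3 ∨ d_K = −4` contradicts `¬ W.HasCM` and — through the leaf's own binders
`IsImaginaryQuadratic K`, `SatisfiesHeegnerHypothesis N K` —
`discr_ne_of_satisfiesHeegnerHypothesis_of_three_dvd`.  Gross 1991, §1 ("`D ≠ 3, 4`") and §2
(non-CM). [folklore] -/
theorem thmA_of_hasCM_or_discr_of_not_hasCM_of_three_dvd (hE : ∀ [W.IsElliptic], ¬ W.HasCM)
    (h3 : 3 ∣ N) : Kolyvagin1990_thmA_of_hasCM_or_discr N W K := by
  intro _ hexc hK hH P _hP _hnt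
  exfalso
  obtain ⟨hD3, hD4⟩ := discr_ne_of_satisfiesHeegnerHypothesis_of_three_dvd hK.1 hH h3
  rcases hexc with h | h | h
  · exact hE h
  · exact hD3 h
  · exact hD4 h

/-- **The leaf `hexc` is idle at `N = N_E` when `3 ‖ N_E`.**  For an elliptic `W / ℚ` with
multiplicative reduction at `3`: `W` has no CM (a CM curve has integral `j`, hence no
multiplicative prime — tree `WeierstrassCurve.not_hasMultiplicativeReductionAtPrime_of_hasCM`,
Silverman *ATAEC* II.6.4 / proof of II.10.5) and `3 ∣ N_E` (bad reduction at `3`; tree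
`WeierstrassCurve.dvd_conductorNorm_iff_not_hasGoodReductionAtPrime`, Diamond–Shurman §8.3), so
`thmA_of_hasCM_or_discr_of_not_hasCM_of_three_dvd` applies at `N = N_E` — `hN` in the currency of
the telescope `KolyvaginAssembly.sha_primary_finite_of_leafInputs_of_poitouTate`
(`∀ [W.IsElliptic], N = W.conductorNorm ℤ`).
[cite: SilvermanATAEC1994, Thm. II.6.4 and proof of Thm. II.10.5 (PDF p. 172)] -/
theorem thmA_of_hasCM_or_discr_of_hasMultiplicativeReductionAtPrime_three
    (hmult : W.HasMultiplicativeReductionAtPrime 3) (hN : ∀ [W.IsElliptic], N = W.conductorNorm ℤ) :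
    Kolyvagin1990_thmA_of_hasCM_or_discr N W K := by
  intro _ hexc hK hH P hP hnt
  have h3 : 3 ∣ N := by
    rw [hN]
    exact (W.dvd_conductorNorm_iff_not_hasGoodReductionAtPrime 3).mpr
      (not_hasGoodReductionAtPrime_of_hasMultiplicativeReductionAtPrime 3 hmult)
  exact thmA_of_hasCM_or_discr_of_not_hasCM_of_three_dvd (K := K)
    (fun hCM ↦ W.not_hasMultiplicativeReductionAtPrime_of_hasCM hCM 3 hmult) h3 hexc hK hH hP hnt

/-- **On the class X11b @ 3 the leaf `hexc` is a tree theorem.**  For `(E, 3)` in `ClassX11b W 3`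
(`r_an = 1 ∧ 3 ≠ 2 ∧ mult(3) ∧ irr(3)`, RESIDUAL-CASES §a.2 row X11b) and `N = N_E`, every
number field `K`: `Kolyvagin1990_thmA_of_hasCM_or_discr N W K`.  Only the conjunct `mult(3)` is
used. [folklore] -/
theorem thmA_of_hasCM_or_discr_of_classX11b_three (hW : ClassX11b W 3)
    (hN : ∀ [W.IsElliptic], N = W.conductorNorm ℤ) :
    Kolyvagin1990_thmA_of_hasCM_or_discr N W K :=
  thmA_of_hasCM_or_discr_of_hasMultiplicativeReductionAtPrime_three hW.2.2.1 hN

end Summit.BirchSwinnertonDyer.Rank1Residual.X11b.Three.KolyvaginHexc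

/-! ### The telescope of record with `hexc` supplied on `3 ‖ N_E` -/

namespace Summit.BirchSwinnertonDyer.Rank1Residual.X11b.Three

open Field IsDedekindDomain Literature.NumberTheory.GaloisRepresentations
open Summit.BirchSwinnertonDyer.Rank1Residual.X11b.KolyvaginAssembly
open Literature.NumberTheory.EllipticCurves.RingClassField
open Literature.NumberTheory.EllipticCurves.ModularForms

-- `K : Type`: the tree's ring-class class field theory is universe `0`.
variable {K : Type} [Field K] [NumberField K] {N : ℕ} {W : WeierstrassCurve ℚ}

/-- **`Kolyvagin1990_sha_primary_finite N W K` on `3 ‖ N_E` from SEVEN cite-only inputs** — the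
Kolyvagin-side telescope of record `sha_primary_finite_of_leafInputs_of_poitouTate`
(`X11b/KolyvaginShaFiniteOfLeafInputs`, x11b3-p2 GEN 13) with its label `hexc` (Kolyvagin's
Theorem A for `E` with CM or `d_K ∈ {−3, −4}`) SUPPLIED by
`KolyvaginHexc.thmA_of_hasCM_or_discr_of_hasMultiplicativeReductionAtPrime_three` from
`hmult : W.HasMultiplicativeReductionAtPrime 3` and the telescope's own `hN : N = N_E`; every
other binder is that theorem's VERBATIM.  CONDITIONAL on EXACTLY {`hPT` (Poitou–Tate named
fact), `hrec`, `hCM`, `h53`, `hGZ`, `hγ`, `hK1`} — cite-only, NOT facts, NOT discharged;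
nothing booked; no mark / label / count / tier moves. [cite: GrossLMS1991, §1 Thm. 1.3 (2), §§3–8]
[cite: McCallumLMS1991, §1 Theorem, Prop. 2.2, §§4–5] -/
theorem sha_primary_finite_of_leafInputs_of_poitouTate_of_mult_three [NeZero N]
    [W.IsGloballyMinimal]
    (hPT : Literature.NumberTheory.GaloisCohomology.poitouTate_sum_localTatePairing_eq_zero K)
    (hN : ∀ [W.IsElliptic], N = W.conductorNorm ℤ)
    (hmult : W.HasMultiplicativeReductionAtPrime 3)
    (hrec : heegnerPointOfConductor_one_galoisConj N W K)
    (hCM : ∀ [W.IsElliptic] (_hK : IsImaginaryQuadratic K) (_hH : SatisfiesHeegnerHypothesis N K)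
      (Dt : ModularParametrizationData W N) (β : ℤ) (ι : K →+* ℂ),
      (4 * N : ℤ) ∣ β ^ 2 - NumberField.discr K →
      ∀ {p M : ℕ}, p.Prime → 1 ≤ M → ∀ (m : ℕ), Squarefree m →
      (∀ q ∈ m.primeFactors, IsKolyvaginPrime N W K p q ∧ FrobEqFrobInfty W K (p ^ M) q) →
      ∃ y : (W.baseChange (ringClassField K ι m)).toAffine.Point,
        WeierstrassCurve.Affine.Point.map (W' := W) (ringClassField K ι m).subtype.toRatAlgHom y =
          heegnerPointComplexOfConductor Dt (NumberField.discr K) β m)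
    (h53 : ∀ [W.IsElliptic] (_hK : IsImaginaryQuadratic K) (_hH : SatisfiesHeegnerHypothesis N K)
      (Dt : ModularParametrizationData W N) (β : ℤ) (ι : K →+* ℂ) {p M : ℕ} (_hp : p.Prime)
      (_hM : 1 ≤ M) {n : ℕ} (_hn : Squarefree n)
      (_hKol : ∀ q ∈ n.primeFactors, IsKolyvaginPrime N W K p q ∧ FrobEqFrobInfty W K (p ^ M) q)
      (d : (m : ℕ) → m ∣ n → KolyvaginHeegnerData Dt β ι m) (m : ℕ) (hm : m ∣ n)
      (τm : ringClassField K ι m ≃ₐ[ℚ] ringClassField K ι m),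
      (∀ x : ringClassField K ι m, ((τm x : ringClassField K ι m) : ℂ) = starRingEnd ℂ x) →
      ∃ σ' ∈ ringClassGal ι m, IsOfFinAddOrder
        (pointGalHom W (ringClassField K ι m) τm (d m hm).y -
          (-W.rootNumber) • pointGalHom W (ringClassField K ι m) σ' (d m hm).y))
    (hGZ : ∀ [W.IsElliptic] (_hK : IsImaginaryQuadratic K) (_hH : SatisfiesHeegnerHypothesis N K)
      (Dt : ModularParametrizationData W N) (β : ℤ) (ι : K →+* ℂ) {p M : ℕ} (_hp : p.Prime)
      (_hp2 : p ≠ 2) (_hρ : W.HasSurjectiveModNGaloisRep p) (_hM : 1 ≤ M) {n : ℕ}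
      (_hn : Squarefree n)
      (_hKol : ∀ q ∈ n.primeFactors, IsKolyvaginPrime N W K p q ∧ FrobEqFrobInfty W K (p ^ M) q)
      (d : (m : ℕ) → m ∣ n → KolyvaginHeegnerData Dt β ι m),
      ∃ n' : ℤ, IsCoprime ((p ^ M : ℕ) : ℤ) n' ∧
        ∀ (m : ℕ) (hm : m ∣ n) (γ : ringClassField K ι m ≃ₐ[ℚ] ringClassField K ι m),
          γ ∈ ringClassGal ι m → ∀ v : HeightOneSpectrum (𝓞 K),
            ¬ (W.baseChange K).HasGoodReductionAt v →
            n' • pointsMap (W.baseChange K) (v.adicCompletion K)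
                ((d m hm).toGeomPoints (pointGalHom W (ringClassField K ι m) γ (d m hm).y)) ∈
              E0Receptacle (W.baseChange K) v ∧
            ∀ (ℓ : ℕ) (hℓ : ℓ ∈ m.primeFactors)
              (hle : ringClassField K ι (m / ℓ) ≤ ringClassField K ι m),
              n' • pointsMap (W.baseChange K) (v.adicCompletion K)
                  ((d m hm).toGeomPoints (pointGalHom W (ringClassField K ι m) γ
                    (WeierstrassCurve.Affine.Point.map (W' := W)
                      ((RingClassField.inclusion ι hle).restrictScalars ℚ)
                      (d (m / ℓ)
                        ((Nat.div_dvd_of_dvd (Nat.dvd_of_mem_primeFactors hℓ)).trans hm)).y))) ∈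
                E0Receptacle (W.baseChange K) v)
    (hγ : ∀ [W.IsElliptic] (_hK : IsImaginaryQuadratic K) (_hH : SatisfiesHeegnerHypothesis N K)
      (Dt : ModularParametrizationData W N) (β : ℤ) (ι : K →+* ℂ) {p M : ℕ} (_hp : p.Prime)
      (_hM : 1 ≤ M) {n : ℕ} (_hn : Squarefree n)
      (_hKol : ∀ q ∈ n.primeFactors, IsKolyvaginPrime N W K p q ∧ FrobEqFrobInfty W K (p ^ M) q)
      (d : (m : ℕ) → m ∣ n → KolyvaginHeegnerData Dt β ι m)
      (m : ℕ) (hm : m ∣ n) (ℓ : ℕ) (hℓ : ℓ ∈ m.primeFactors) [Fact ℓ.Prime]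
      (hΔ : ¬ (ℓ : ℤ) ∣ minimalDiscriminantInt W) (φ₀ : absoluteGaloisGroup (ZMod ℓ)),
      (∀ x : AlgebraicClosure (ZMod ℓ), φ₀ • x = x ^ ℓ) →
      ∀ (hle : ringClassField K ι (m / ℓ) ≤ ringClassField K ι m)
        (γ : ringClassField K ι m ≃ₐ[ℚ] ringClassField K ι m), γ ∈ ringClassGal ι m →
        geomReduction hΔ ((RatClosure.pointsEquiv (K := K) W).symm
            ((d m hm).toGeomPoints (pointGalHom W (ringClassField K ι m) γ (d m hm).y))) =
          φ₀ • geomReduction hΔ ((RatClosure.pointsEquiv (K := K) W).symm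
            ((d m hm).toGeomPoints (pointGalHom W (ringClassField K ι m) γ
              (WeierstrassCurve.Affine.Point.map (W' := W)
                ((RingClassField.inclusion ι hle).restrictScalars ℚ)
                (d (m / ℓ)
                  ((Nat.div_dvd_of_dvd (Nat.dvd_of_mem_primeFactors hℓ)).trans hm)).y)))))
    (hK1 : ∀ [W.IsElliptic] (_hE : ¬ W.HasCM)
      (_hD : NumberField.discr K ≠ -3 ∧ NumberField.discr K ≠ -4) (_hK : IsImaginaryQuadratic K)
      (_hH : SatisfiesHeegnerHypothesis N K) {P : (W.baseChange K).toAffine.Point}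
      (_hP : IsHeegnerPoint N W K P) (_hnt : ¬ IsOfFinAddOrder P) (p : ℕ) (_hp : p.Prime),
      (p = 2 ∨ ¬ W.HasSurjectiveModNGaloisRep p) →
      Set.Finite {c : (W.baseChange K).sha | ∃ j : ℕ, p ^ j • c = 0}) :
    Kolyvagin1990_sha_primary_finite N W K :=
  sha_primary_finite_of_leafInputs_of_poitouTate hPT
    (KolyvaginHexc.thmA_of_hasCM_or_discr_of_hasMultiplicativeReductionAtPrime_three hmult hN)
    hN hrec hCM h53 hGZ hγ hK1

end Summit.BirchSwinnertonDyer.Rank1Residual.X11b.Three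

end
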